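import Summits.CriticalPhenomena.PercolationContinuityZ3.Theorems.PercNearOneGluingNoHeavyLowerTailSahiCTCLadderSupplyGeneralCube
import HarnessLib

/-!
# `NoHeavyLowerTail` (crux stmt-CriticalPhenomena-4575), P3 lane: supply of a cube TYPE (general row) and the pinned weights

Support file (seat `prim-l12-p3`, gen 26; `--supports stmt-CriticalPhenomena-4575`).  README blueprint step 2, general form, last
generic part: summing `cube_plain_supply` over the cubes `(A, Y)` with `#A = i`, `#Y = t − i` (`type_plain_supply`), and the pinned
weights `Σ_{p ∈ A} #{kinds with p ∈ A'} = (#A + j − #D) · #kindsIn_j`, `Σ_{p ∈ A} #{kinds with p ∉ A'} = (#D − j) · #kindsIn_j`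
(`sum_card_kindsIn_filter_mem`, `sum_card_kindsIn_filter_not_mem`).  What is left per row is `sum_card_kindsIn` + normalisation.
Nothing is asserted about the crux.
-/

namespace Summit.CriticalPhenomena.PercolationContinuityZ3.Theorems.SahiCTCForms

open Finset MvPolynomial SahiCTCGenFun SahiCTCWeightedLYM

variable {α : Type*} [DecidableEq α] [Fintype α]

section SupplyGeneralType
variable {𝒳 𝒵 : Finset (Finset α)}

omit [Fintype α] in
/-- The free set of a cube of type `i` has `i + (#T − (t − i))` points. [this work] -/
theorem card_free_of_type {m : α →₀ ℕ} {t i : ℕ} {c : Finset α × Finset α}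
    (hc : c ∈ (dbl m).powersetCard i ×ˢ (lev m 1).powersetCard (t - i)) :
    #(c.1 ∪ (lev m 1 \ c.2)) = i + (#(lev m 1) - (t - i)) ∧ #(dbl m \ c.1) = #(dbl m) - i ∧ c.1 ⊆ dbl m := by
  obtain ⟨hA, hY⟩ := mem_product.1 hc
  obtain ⟨hAD, hAc⟩ := mem_powersetCard.1 hA
  obtain ⟨hYT, hYc⟩ := mem_powersetCard.1 hY
  refine ⟨?_, by rw [card_sdiff_of_subset hAD, hAc], hAD⟩
  rw [card_union_of_disjoint (Disjoint.mono hAD sdiff_subset (disjoint_dbl_lev_one m)), card_sdiff_of_subset hYT, hAc, hYc]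

omit [Fintype α] in
/-- **Plain supply of a cube type**: `cH(ℓ_i, f_i) · Σ_{cubes of type i} Σ_j #kindsIn_j ≤ C(f_i, ℓ_i) · Σ_{cubes of type i} κ` with
`f_i = i + (#T − (t − i))`, `ℓ_i = t − (#D − i)`. [this work] -/
theorem type_plain_supply (h𝒳 : IsUpperSet (𝒳 : Set (Finset α))) (h𝒵 : IsUpperSet (𝒵 : Set (Finset α))) {t : ℕ}
    (hXt : ∀ S ∈ 𝒳, t ≤ #S) (hZt : ∀ S ∈ 𝒵, t ≤ #S) {m : α →₀ ℕ} (hδt : #(dbl m) ≤ t) (i : ℕ) :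
    (cH (t - (#(dbl m) - i)) (i + (#(lev m 1) - (t - i))) : ℤ) *
        ∑ c ∈ (dbl m).powersetCard i ×ˢ (lev m 1).powersetCard (t - i),
          ∑ j ∈ range (#(dbl m) + 1), (#(kindsIn 𝒳 𝒵 m t j c.1 c.2) : ℤ)
      ≤ (((i + (#(lev m 1) - (t - i))).choose (t - (#(dbl m) - i)) : ℕ) : ℤ) *
        ∑ c ∈ (dbl m).powersetCard i ×ˢ (lev m 1).powersetCard (t - i), kap 𝒳 𝒵 (dbl m \ c.1) (c.1 ∪ (lev m 1 \ c.2)) := by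
  rw [mul_sum, mul_sum]
  refine sum_le_sum fun c hc => ?_
  obtain ⟨hF, hB, hAD⟩ := card_free_of_type hc
  have h := cube_plain_supply h𝒳 h𝒵 hXt hZt (Y := c.2) hAD hδt
  rw [hF, hB] at h
  exact h

omit [Fintype α] in
/-- `Σ_{p ∈ A} #{q ∈ K : p ∈ q.1} = Σ_{q ∈ K} #(A ∩ q.1)`. [folklore] -/
theorem sum_card_filter_mem_fst (A : Finset α) (K : Finset (Finset α × Finset α)) :
    ∑ p ∈ A, #(K.filter fun q => p ∈ q.1) = ∑ q ∈ K, #(A ∩ q.1) := by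
  simp_rw [card_eq_sum_ones, sum_filter]
  rw [sum_comm]
  refine sum_congr rfl fun q _ => ?_
  rw [← sum_filter, filter_mem_eq_inter]

omit [Fintype α] in
/-- `Σ_{p ∈ A} #{q ∈ K : p ∉ q.1} = Σ_{q ∈ K} #(A ∖ q.1)`. [folklore] -/
theorem sum_card_filter_not_mem_fst (A : Finset α) (K : Finset (Finset α × Finset α)) :
    ∑ p ∈ A, #(K.filter fun q => p ∉ q.1) = ∑ q ∈ K, #(A \ q.1) := by
  simp_rw [card_eq_sum_ones, sum_filter]
  rw [sum_comm]
  refine sum_congr rfl fun q _ => ?_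
  rw [← sum_filter]
  congr 1; ext x; simp [mem_sdiff]

omit [Fintype α] in
/-- **Pinned weight, `p ∈ A'`**: `Σ_{p ∈ A} #{kinds_j in the cube with p ∈ A'} = (#A + j − #D) · #kindsIn_j(A,Y)`. [this work] -/
theorem sum_card_kindsIn_filter_mem {m : α →₀ ℕ} {t j : ℕ} {A Y : Finset α} (hA : A ⊆ dbl m) :
    ∑ p ∈ A, #((kindsIn 𝒳 𝒵 m t j A Y).filter fun q => p ∈ q.1) = (#A + j - #(dbl m)) * #(kindsIn 𝒳 𝒵 m t j A Y) := by
  rw [sum_card_filter_mem_fst, mul_comm]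
  exact sum_const_nat fun q hq => by have := (card_inter_fst_of_mem_kindsIn hA hq).1; omega

omit [Fintype α] in
/-- **Pinned weight, `p ∉ A'`**: `Σ_{p ∈ A} #{kinds_j in the cube with p ∉ A'} = (#D − j) · #kindsIn_j(A,Y)`. [this work] -/
theorem sum_card_kindsIn_filter_not_mem {m : α →₀ ℕ} {t j : ℕ} {A Y : Finset α} (hA : A ⊆ dbl m) :
    ∑ p ∈ A, #((kindsIn 𝒳 𝒵 m t j A Y).filter fun q => p ∉ q.1) = (#(dbl m) - j) * #(kindsIn 𝒳 𝒵 m t j A Y) := by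
  rw [sum_card_filter_not_mem_fst, mul_comm]
  exact sum_const_nat fun q hq => by have := (card_inter_fst_of_mem_kindsIn hA hq).2; omega

end SupplyGeneralType

end Summit.CriticalPhenomena.PercolationContinuityZ3.Theorems.SahiCTCForms
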